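import Summits.HodgeConjecture.HodgeConjecture.Theorems.F0P6aKottwitzAtOmegaOfComplexPoints   -- ★ p847344: `comp_eq_comp_of_isGalois`
import Summits.HodgeConjecture.HodgeConjecture.Theorems.F0P6aKottwitzCountAtSplitPlace        -- ★ p847313: the restriction currency `τR`, `closureValuationSubring`
import HarnessLib

/-!
# Crux `HLiu418` — P6 sub-line **F0-P6a**, organ #5 «PIN-INDEP»: the canonical twist ideal does not depend on the complex embedding `σ₀` nor on the restriction family `τR`

Cell `hodgecm-mathlib` (D-0151), crux `stmt-HodgeConjecture-24832` (HLiu418), `--supports` only (count-neutral).  LA4-plan (g0) DEAL #6 03:27:38Z → LA4-p04 (g0).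
THEOREMS ONLY (no definition, no `sorry`, no new named fact).

THE POINT.  The E-READINGS leaf ED. 2 (`Lines/F0_P6a_EReadings.lean`, cand v5) pins the twist ideal of a Frobenius reading to the CANONICAL TWIST IDEAL
`𝔞_can(m, τR, w) = ∏_{τ : m τ ≠ 0, τ ∤ c•w} ker (residue ∘ τR τ)` (★ p847883 ∕ organ #4 token) with `m τ := mOf ι₁ Φ (σ₀ ∘ τ)`, for EVERY complex embedding
`σ₀ : F̄_w →+* ℂ` over `ι₁` and EVERY restriction family `τR` with `τR_spec`; the E-payer chooses ONE `(σ₁, τR₁)` for the `∃`-witness, so the (FROB-can) row for an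
arbitrary `(σ₀, τR)` is this independence statement: **`canonicalTwistIdeal_indep`** — for `F ∕ ℚ` Galois the token is the same for all such `(σ₀, τR)`.  PROOF: the
restriction family is UNIQUE (`τR_spec` pins the values in `F̄_w`, and `R ↪ F̄_w` is injective — `Subtype.val_injective`), and `σ₀ ∘ τ = σ₀' ∘ τ` for every
`τ : F →+* F̄_w` as soon as `σ₀`, `σ₀'` agree on `F` (★ `comp_eq_comp_of_isGalois`: `τ = τ_w ∘ g` by normality).  Stated for an ARBITRARY signature function
`M : (F →+* L) → ℕ` on the embeddings into any field `L` (the consumer takes `L := ℂ`, `M := mOf ι₁ Φ`, which lives in a `Lines` file a `Theorems` file cannot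
import) and an arbitrary excluded block `I` (the consumer takes `I := 𝔭_{c•w}`).

HC_CM is proved only modulo the 7 printed citations (2 remaining named inputs hLiu418 24832, h413 24833) until rung 0 closes; nothing here changes a count.
[cite: RapoportSmithlingZhang2020Diagonal, §4.1 (4.6) p. 16 and p. 17; Remark 3.6 (i) (3.14) p. 13] [cite: Shimura1998, §13.1 Thm. 1 (pp. 97–99)] [cite: NeukirchANT1999, Ch. II (8.1)]
-/

set_option autoImplicit false
set_option linter.dupNamespace false  -- `Summit.HodgeConjecture.HodgeConjecture.…` BY DESIGN (D-0017)

noncomputable section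

open NumberField IsDedekindDomain IsLocalRing
open Literature.NumberTheory.GaloisRepresentations (closureValuationSubring)
open Summit.HodgeConjecture.HodgeConjecture.Theorems.F0P6aKottwitzAtOmegaOfComplexPoints (comp_eq_comp_of_isGalois)

namespace Summit.HodgeConjecture.HodgeConjecture.Theorems.F0P6aCanonicalTwistIdealIndep

variable {F : Type} [Field F] [NumberField F] (w : HeightOneSpectrum (𝓞 F))

/-- **THE RESTRICTION FAMILY IS UNIQUE**: two families `τR`, `τR'` of restrictions `𝓞 F →+* R` with the same values in `F̄_w` (`τR_spec`) are equal
(`R ↪ F̄_w` injective). [cite: NeukirchANT1999, Ch. II (4.8)] -/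
theorem restrict_unique
    (τR τR' : (F →+* AlgebraicClosure (w.adicCompletion F)) → (𝓞 F →+* ↥(closureValuationSubring (w.adicCompletion F))))
    (hτR : ∀ (τ : F →+* AlgebraicClosure (w.adicCompletion F)) (x : 𝓞 F),
      ((τR τ x : ↥(closureValuationSubring (w.adicCompletion F))) : AlgebraicClosure (w.adicCompletion F)) = τ (x : F))
    (hτR' : ∀ (τ : F →+* AlgebraicClosure (w.adicCompletion F)) (x : 𝓞 F),
      ((τR' τ x : ↥(closureValuationSubring (w.adicCompletion F))) : AlgebraicClosure (w.adicCompletion F)) = τ (x : F)) :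
    τR = τR' :=
  funext fun τ => RingHom.ext fun x => Subtype.val_injective (by rw [hτR, hτR'])

/-- **ORGAN #5 «PIN-INDEP» — THE CANONICAL TWIST IDEAL TOKEN IS INDEPENDENT OF `(σ₀, τR)`** (`F ∕ ℚ` Galois): for complex(-or any field-)valued embeddings
`σ₀`, `σ₀'` of `F̄_w` agreeing on `F` (`σ₀ ∘ (F → F̄_w) = ι₁ = σ₀' ∘ (F → F̄_w)`), restriction families `τR`, `τR'` with `τR_spec`, any signature function `M` on the
`L`-valued embeddings of `F` and any excluded block `I`:
`∏_{τ : M(σ₀ ∘ τ) ≠ 0, ker (residue ∘ τR τ) ≠ I} ker (residue ∘ τR τ) = ∏_{τ : M(σ₀' ∘ τ) ≠ 0, ker (residue ∘ τR' τ) ≠ I} ker (residue ∘ τR' τ)`.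
USE (E-READINGS ED. 2 (FROB-can) with the E-payer՚s fixed witness `(σ₁, τR₁)`): `L := ℂ`, `M := mOf ι₁ Φ`, `I := 𝔭_{c•w}`.
[cite: RapoportSmithlingZhang2020Diagonal, §4.1 (4.6) p. 16 and p. 17; Remark 3.6 (i) (3.14) p. 13] [cite: Shimura1998, §13.1 Thm. 1 (pp. 97–99)] -/
theorem canonicalTwistIdeal_indep [IsGalois ℚ F] {L : Type} [Field L] (ι₁ : F →+* L) (M : (F →+* L) → ℕ) (I : Ideal (𝓞 F))
    (σ₀ σ₀' : AlgebraicClosure (w.adicCompletion F) →+* L)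
    (hσ₀ : σ₀.comp (algebraMap F (AlgebraicClosure (w.adicCompletion F))) = ι₁)
    (hσ₀' : σ₀'.comp (algebraMap F (AlgebraicClosure (w.adicCompletion F))) = ι₁)
    (τR τR' : (F →+* AlgebraicClosure (w.adicCompletion F)) → (𝓞 F →+* ↥(closureValuationSubring (w.adicCompletion F))))
    (hτR : ∀ (τ : F →+* AlgebraicClosure (w.adicCompletion F)) (x : 𝓞 F),
      ((τR τ x : ↥(closureValuationSubring (w.adicCompletion F))) : AlgebraicClosure (w.adicCompletion F)) = τ (x : F))
    (hτR' : ∀ (τ : F →+* AlgebraicClosure (w.adicCompletion F)) (x : 𝓞 F),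
      ((τR' τ x : ↥(closureValuationSubring (w.adicCompletion F))) : AlgebraicClosure (w.adicCompletion F)) = τ (x : F)) :
    ∏ τ ∈ Finset.univ.filter (fun τ : F →+* AlgebraicClosure (w.adicCompletion F) =>
        M (σ₀.comp τ) ≠ 0 ∧ RingHom.ker ((residue ↥(closureValuationSubring (w.adicCompletion F))).comp (τR τ)) ≠ I),
      RingHom.ker ((residue ↥(closureValuationSubring (w.adicCompletion F))).comp (τR τ)) =
    ∏ τ ∈ Finset.univ.filter (fun τ : F →+* AlgebraicClosure (w.adicCompletion F) =>
        M (σ₀'.comp τ) ≠ 0 ∧ RingHom.ker ((residue ↥(closureValuationSubring (w.adicCompletion F))).comp (τR' τ)) ≠ I),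
      RingHom.ker ((residue ↥(closureValuationSubring (w.adicCompletion F))).comp (τR' τ)) := by
  obtain rfl : τR = τR' := restrict_unique w τR τR' hτR hτR'
  have hσ : ∀ τ : F →+* AlgebraicClosure (w.adicCompletion F), σ₀.comp τ = σ₀'.comp τ :=
    comp_eq_comp_of_isGalois F (algebraMap F (AlgebraicClosure (w.adicCompletion F))) σ₀ σ₀' (hσ₀.trans hσ₀'.symm)
  have hfilter : (Finset.univ.filter fun τ : F →+* AlgebraicClosure (w.adicCompletion F) =>
        M (σ₀.comp τ) ≠ 0 ∧ RingHom.ker ((residue ↥(closureValuationSubring (w.adicCompletion F))).comp (τR τ)) ≠ I) =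
      Finset.univ.filter fun τ : F →+* AlgebraicClosure (w.adicCompletion F) =>
        M (σ₀'.comp τ) ≠ 0 ∧ RingHom.ker ((residue ↥(closureValuationSubring (w.adicCompletion F))).comp (τR τ)) ≠ I :=
    Finset.filter_congr fun τ _ => by rw [hσ τ]
  rw [hfilter]

end Summit.HodgeConjecture.HodgeConjecture.Theorems.F0P6aCanonicalTwistIdealIndep

end
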